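import Summits.AtomisticToContinuum.HydrodynamicLimit.Theorems.CollisionIsometryCLTMacroClosureEngineReadoutA
import Summits.AtomisticToContinuum.HydrodynamicLimit.Theorems.CollisionIsometryCLTMacroClosureEngineDefs
import Summits.AtomisticToContinuum.HydrodynamicLimit.Theorems.CollisionIsometryCLTMacroClosureStubThermoLambda
import Summits.AtomisticToContinuum.HydrodynamicLimit.Theorems.CollisionIsometryCLTMacroClosureStubClausiusStatics
import Summits.AtomisticToContinuum.HydrodynamicLimit.Theorems.CollisionIsometryCLTMacroClosureStubClausiusLimits
import HarnessLib

/-!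
# Sub-goal `engine_readout` of the lead's `stub_engine_pointwise` (line `IdeatorTwoGen1Sketch`, crux
# `MacroClosure`, stmt-AtomisticToContinuum-14870): the coercive readout

The last step of the barycentric Gronwall. At a time `t ∈ [0, T)`, on measurable good events `G_N ⊆ good`
with `P_N(G_Nᶜ) → 0` on which every block of the evolved configuration `Φ_t z` lies in the band
`c₁ ≤ ρ̄ ≤ σ⁻³`, the Gronwall output `E_N[𝟙_{G_N} ∫ₓ h_σ(Ū_N(t,x) | U_cl(t,x)) dx] → 0` forces the law of
large numbers of the three empirical fields at time `t` (`TendstoHydroFieldsAt`).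

Proof. (1) COERCIVITY: `K = U_cl(t, 𝕋³)` is a compact part of the chamber, so clause 2 of `ThermoChamber`
gives `m · min(‖Ū − U‖², ‖Ū − U‖) ≤ h_σ(Ū | U)` for strictly physical blocks `Ū`; on `G_N`, for `N` large
(`C (N+1)^{3γ} < (N+1) c₁`, from `γ ≤ 1/15`) every band block carries two particles, and the velocities of
`Φ_t z` are a.s. pairwise distinct (`Clausius.ae_pairwise_vel_ne`), so every block is strictly physical;
Ruelle convexity (`HsFreeEnergyConvex`) makes `x ↦ η_σ(Ū(x))` continuous on the band, so `∫ₓ h_σ` is an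
honest integral. (2) FROM `min` TO `L¹`: `d ≤ κ/2 + (1 + 2/κ) min(d², d)` pointwise, whence
`∫ₓ ‖Ū − U‖ ≤ κ/2 + (1 + 2/κ) m⁻¹ ∫ₓ h_σ`. (3) FIELDS: the mollifier commutators
`|⟨emp, χ g⟩ − ∫ₓ χ ⟨emp, φ(· − x) g⟩|` are `≤ ω_χ(r_N) ⟨emp, |g|⟩` by uniform continuity of `χ`
(`g = 1, v, |v|²/2`; the kinetic energy per particle is `∫ₓ Ē ≤ ∫ₓ ‖Ū − U‖ + ∫ₓ E_cl`), and
`|∫ χ ρ̄ − ∫ χ ρ_t| ≤ ‖χ‖_∞ ∫ₓ ‖Ū − U‖` (same for momentum / energy). (4) MARKOV on `𝟙_{G_N} ∫ₓ h_σ` and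
`P(G_Nᶜ) → 0`. The deterministic and measure-theoretic lemmas of steps (1)–(4) are the landed part A
(`CollisionIsometryCLTMacroClosureEngineReadoutA.lean`, namespace `Barycentric.EngineReadout`).

STATEMENT: the registered signature of `engine_readout` with the two hypotheses of `stub_engine_pointwise` it
needs threaded in — `StiffCollisionalRelaxation.HsFreeEnergyConvex` (after `σ ≤ 1 / 2`) and `γ ≤ 1 / 15`
(after `0 < γ`).
-/

noncomputable section

open MeasureTheory Filter Set Topology InformationTheory
open scoped ENNReal ContDiff

namespace Summit.AtomisticToContinuum.HydrodynamicLimit.Theorems.MacroClosureLine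

open Literature.MathematicalPhysics.KineticTheory Literature.Analysis.FluidPDE
open Literature.Analysis.FunctionSpaces
open Summit.AtomisticToContinuum.HydrodynamicLimit.Theses

namespace Barycentric

open EngineReadout in
/-- **`engine_readout` (registered sub-goal of `stub_engine_pointwise`): the coercive readout.** At a time
`t ∈ [0, T)`, on measurable good events `G_N ⊆ good` with `P_N(G_Nᶜ) → 0` on which all blocks of `Φ_t z`
lie in the band `c₁ ≤ ρ̄ ≤ σ⁻³`, if `E_N[𝟙_{G_N} ∫ₓ h_σ(Ū_N(t,x) | U_cl(t,x)) dx] → 0` then the empirical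
density, momentum and energy fields at time `t` converge in probability to `(ρ, ρu, E)(t)`: coercivity of
`h_σ` on the compact `U_cl(t, 𝕋³) ⊆ chamber` (clause 2 of `ThermoChamber`; blocks are strictly physical a.s.
for `N` large by `γ ≤ 1/15` and a.s. distinct velocities; `x ↦ η_σ(Ū(x))` is continuous by Ruelle
convexity), `min(d², d)`-to-`L¹`, mollifier commutators by uniform continuity of `χ`, and Markov.
[cite: Dafermos2005, Thm 5.2.1] -/
theorem engine_readout : ∀ (σ : ℝ), 0 < σ → σ ≤ 1 / 2 → StiffCollisionalRelaxation.HsFreeEnergyConvex → ∀ (a₀ θ₀ : T3 → ℝ) (u₀ : T3 → V3), Continuous a₀ → Continuous θ₀ → Continuous u₀ → (∀ x, 0 < a₀ x) → (∀ x, 0 < θ₀ x) → ∀ (T : ℝ) (ρ θ : ℝ → T3 → ℝ) (u : ℝ → T3 → V3), IsHardSphereEulerSolution σ T ρ u θ → ∀ η₃ : ℝ, ThermoChamber η₃ → (∀ s ∈ Ico 0 T, ∀ x, ρ s x * σ ^ 3 < η₃) → ∀ (Φ : (N : ℕ) → Flow σ N) (γ C : ℝ) (φ : ℕ → T3 → ℝ),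 0 < γ → γ ≤ 1 / 15 → AdmissibleKernel γ C φ → ∀ t ∈ Ico 0 T, ∀ c₁ : ℝ, 0 < c₁ → ∀ G : (N : ℕ) → Set (Config (N + 1) (Fin 3) T3), (∀ N, MeasurableSet (G N)) → (∀ N, G N ⊆ (Φ N).good) → (∀ N, ∀ z ∈ G N, ∀ x, c₁ ≤ bρ (φ N) ((Φ N).flow t z) x ∧ bρ (φ N) ((Φ N).flow t z) x * σ ^ 3 ≤ 1) → Tendsto (fun N : ℕ => localGibbsLaw σ a₀ u₀ θ₀ N (Φ N) (G N)ᶜ) atTop (𝓝 0) → (∀ N, Integrable (fun z => (G N).indicator (fun z => ∫ x, relEnt σ (bU (φ N) ((Φ N).flow t z) x) (Ucl ρ θ u t x)) z) (localGibbsLaw σ a₀ u₀ θ₀ N (Φ N))) → Tendsto (fun N : ℕ => ∫ z, (G N).indicator (fun z => ∫ x, relEnt σ (bU (φ N) ((Φ N).flow t z) x) (Ucl ρ θ u t x)) z ∂(localGibbsLaw σ a₀ u₀ θ₀ N (Φ N))) atTop (𝓝 0) → TendstoHydroFieldsAt (fun N => localGibbsLaw σ a₀ u₀ θ₀ N (Φ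 N)) Φ ρ u θ t := by
  intro σ hσ hσ2 hH a₀ θ₀ u₀ ha hθc hu ha0 hθ0 T ρ θ u hE η₃ hT hch Φ γ C φ hγ hγ15 hφ t ht c₁ hc₁ G _hGm
    _hGg hGb hGc hGi hlim
  -- the laws
  set P : (N : ℕ) → Measure (Config (N + 1) (Fin 3) T3) := fun N => localGibbsLaw σ a₀ u₀ θ₀ N (Φ N)
  haveI hPprob : ∀ N, IsProbabilityMeasure (P N) := fun N =>
    isProbabilityMeasure_localGibbsLaw ha hθc hu ha0 hθ0 hσ2 N (Φ N)
  -- the classical state at time `t`: a compact part of the chamber; coercivity (clause 2)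
  set U : T3 → State := Ucl ρ θ u t
  have hUc : Continuous U := ((isSmoothSpaceTimeOn_stateOf hE).isSmooth_slice ht).continuous
  have hUmem : ∀ x, U x ∈ chamber σ η₃ := fun x =>
    stateOf_mem_chamber (u t x) (hE.density_pos t ht x) (hE.temperature_pos t ht x) (hch t ht x)
  have hηU : Continuous fun x => hsEntropy σ (U x) :=
    (hT σ hσ).1.1.continuousOn.comp_continuous hUc hUmem
  have hΛU : Continuous fun x => fderiv ℝ (hsEntropy σ) (U x) :=
    ((hT σ hσ).1.1.continuousOn_fderiv_of_isOpen (isOpen_chamber σ η₃) (by simp)).comp_continuous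
      hUc hUmem
  obtain ⟨m, hm, hcoer⟩ := (hT σ hσ).2.1 (range U) (isCompact_range hUc)
    (by rintro _ ⟨x, rfl⟩; exact hUmem x)
  have hcoerU : ∀ x, ∀ V : State, 0 < V.1 → V.1 * σ ^ 3 < 11 / 10 → ‖V.2.1‖ ^ 2 < 2 * V.1 * V.2.2 →
      m * min (‖V - U x‖ ^ 2) ‖V - U x‖ ≤ relEnt σ V (U x) :=
    fun x V h1 h2 h3 => hcoer (U x) ⟨x, rfl⟩ V h1 h2 h3
  -- the kernels; Ruelle continuity of `f_ex` on the band packings; `N` large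
  obtain ⟨hφs, hφ0, hφ1, hφsupp, hφb, -⟩ := hφ
  have hφc : ∀ N, Continuous (φ N) := fun N => (hφs N).continuous
  have hσ3 : 0 < σ ^ 3 := pow_pos hσ 3
  have hfex : ContinuousOn hsExcessFreeEnergy (Icc (c₁ * σ ^ 3) 1) :=
    (Clausius.continuousOn_hsExcessFreeEnergy hH).mono fun r hr =>
      ⟨(mul_pos hc₁ hσ3).trans_le hr.1, hr.2.trans_lt (by norm_num)⟩
  have hev1 : ∀ᶠ N : ℕ in atTop, C * ((N : ℝ) + 1) ^ (3 * γ) < ((N + 1 : ℕ) : ℝ) * c₁ :=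
    Clausius.eventually_kernel_lt (by linarith) hc₁
  have hrad : Tendsto (fun N : ℕ => ((N : ℝ) + 1) ^ (-γ)) atTop (𝓝 0) :=
    (tendsto_rpow_neg_atTop hγ).comp (tendsto_natCast_atTop_atTop.atTop_add tendsto_const_nhds)
  -- the test function and the tolerances
  intro χ hχ δ hδ
  obtain ⟨Cχ, hCχ0, hCχ⟩ := exists_forall_abs_le_of_continuous hχ
  set Etot : ℝ := ∫ x, (U x).2.2
  set κ : ℝ := min 1 (δ / (4 * (Cχ + 1)))
  have hκ : 0 < κ := lt_min one_pos (by positivity)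
  have hκ1 : κ ≤ 1 := min_le_left _ _
  have hCκ : Cχ * κ ≤ δ / 4 := by
    have h1 : Cχ * κ ≤ Cχ * (δ / (4 * (Cχ + 1))) := mul_le_mul_of_nonneg_left (min_le_right _ _) hCχ0
    have h3 : Cχ / (Cχ + 1) ≤ 1 := by rw [div_le_one (by positivity)]; linarith
    calc Cχ * κ ≤ Cχ * (δ / (4 * (Cχ + 1))) := h1
      _ = Cχ / (Cχ + 1) * (δ / 4) := by rw [mul_comm (4 : ℝ), ← div_div]; ring
      _ ≤ 1 * (δ / 4) := mul_le_mul_of_nonneg_right h3 (by positivity)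
      _ = δ / 4 := one_mul _
  set ε₁ : ℝ := δ / (4 * (|Etot| + 2)) with hε₁def
  have hε₁ : 0 < ε₁ := by positivity
  have h4E : (0 : ℝ) < 4 * (|Etot| + 2) := by positivity
  have hε₁b : ε₁ * (4 * (|Etot| + 2)) = δ := by
    rw [hε₁def, div_mul_eq_mul_div, mul_div_assoc, div_self (ne_of_gt h4E), mul_one]
  have hεE : 0 ≤ ε₁ * |Etot| := mul_nonneg hε₁.le (abs_nonneg _)
  obtain ⟨δ₁, hδ₁, hmodχ⟩ := MesoLLN.exists_forall_euclidDist_lt_norm_sub_lt hχ hε₁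
  have hmod : ∀ x y, Torus.euclidDist y x < δ₁ → |χ y - χ x| ≤ ε₁ := fun x y hxy => by
    have h := hmodχ y x hxy
    rw [Real.norm_eq_abs] at h
    exact h.le
  have hev2 : ∀ᶠ N : ℕ in atTop, ((N : ℝ) + 1) ^ (-γ) ≤ δ₁ := hrad.eventually_le_const hδ₁
  -- the Markov threshold and the integrand of the hypothesis
  set κ' : ℝ := κ / 2 * m / (1 + 2 / κ) with hκ'def
  have hκ' : 0 < κ' := by positivity
  set f : (N : ℕ) → Config (N + 1) (Fin 3) T3 → ℝ := fun N z =>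
    (G N).indicator (fun z => ∫ x, relEnt σ (bU (φ N) ((Φ N).flow t z) x) (U x)) z
  -- CORE: for `N` large, a.s., on `G N` either all three deviations are `≤ δ/2` or `f ≥ κ'`
  have hcore : ∀ᶠ N in atTop, (0 ≤ᵐ[P N] f N) ∧ ∀ᵐ z ∂P N, z ∈ G N →
      (|empiricalDensityField ((Φ N).flow t z) χ - ∫ x, χ x * ρ t x| ≤ δ / 2 ∧
        ‖empiricalMomentumField ((Φ N).flow t z) χ - ∫ x, (χ x * ρ t x) • u t x‖ ≤ δ / 2 ∧
        |empiricalEnergyField ((Φ N).flow t z) χ -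
          ∫ x, χ x * totalEnergyDensity (ρ t x) (u t x) (θ t x)| ≤ δ / 2) ∨ κ' ≤ f N z := by
    filter_upwards [hev1, hev2] with N hN1 hN2
    have hae := Clausius.ae_pairwise_vel_ne a₀ u₀ θ₀ (Φ N) t
    have hsuppN : ∀ y, δ₁ ≤ Torus.euclidDist y 0 → φ N y = 0 := fun y hy =>
      hφsupp N y (hN2.trans hy)
    -- the deterministic estimates for one good configuration with distinct velocities
    have hdet : ∀ z ∈ G N, (∀ i j : Fin (N + 1), i ≠ j → ((Φ N).flow t z i).2 ≠ ((Φ N).flow t z j).2) →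
        0 ≤ f N z ∧ ((|empiricalDensityField ((Φ N).flow t z) χ - ∫ x, χ x * ρ t x| ≤ δ / 2 ∧
          ‖empiricalMomentumField ((Φ N).flow t z) χ - ∫ x, (χ x * ρ t x) • u t x‖ ≤ δ / 2 ∧
          |empiricalEnergyField ((Φ N).flow t z) χ -
            ∫ x, χ x * totalEnergyDensity (ρ t x) (u t x) (θ t x)| ≤ δ / 2) ∨ κ' ≤ f N z) := by
      intro z hzG hvel
      set w : Config (N + 1) (Fin 3) T3 := (Φ N).flow t z
      obtain ⟨-, h0, hD'⟩ := coercive_readout hσ hc₁ hm hfex (hφc N) (hφ0 N) (hφb N) hN1 hUc hηU hΛU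
        hcoerU (hGb N z hzG) hvel hκ
      set D : ℝ := ∫ x, ‖bU (φ N) w x - U x‖
      set I : ℝ := ∫ x, relEnt σ (bU (φ N) w x) (U x)
      have hD : D ≤ κ / 2 + (1 + 2 / κ) / m * I := hD'
      have hfz : f N z = I := indicator_of_mem hzG _
      have hI0 : 0 ≤ I := integral_nonneg h0
      refine ⟨by rw [hfz]; exact hI0, ?_⟩
      rcases le_or_gt D κ with hDκ | hDκ
      · left
        have he : empiricalEnergyField w (fun _ => (1 : ℝ)) ≤ D + Etot := energy_le (hφc N) (hφ1 N) hUc w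
        have heb : empiricalEnergyField w (fun _ => (1 : ℝ)) ≤ 1 + |Etot| := by
          linarith [le_abs_self Etot]
        have hCD : Cχ * D ≤ δ / 4 := (mul_le_mul_of_nonneg_left hDκ hCχ0).trans hCκ
        refine ⟨?_, ?_, ?_⟩
        · have h1 := density_comm (hφc N) (hφ0 N) (hφ1 N) hsuppN hχ hmod w
          have h2 : |(∫ x, χ x * bρ (φ N) w x) - ∫ x, χ x * ρ t x| ≤ Cχ * D :=
            density_dev hχ hCχ (hφc N) hUc w
          calc |empiricalDensityField w χ - ∫ x, χ x * ρ t x|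
              ≤ |empiricalDensityField w χ - ∫ x, χ x * bρ (φ N) w x| +
                |(∫ x, χ x * bρ (φ N) w x) - ∫ x, χ x * ρ t x| := abs_sub_le _ _ _
            _ ≤ ε₁ + Cχ * D := add_le_add h1 h2
            _ ≤ δ / 2 := by linarith
        · have h1 := momentum_comm (hφc N) (hφ0 N) (hφ1 N) hsuppN hχ hmod w
          have h3 : (fun x => (χ x * ρ t x) • u t x) = fun x => χ x • (U x).2.1 :=
            funext fun x => mul_smul (χ x) (ρ t x) (u t x)
          have h2 : ‖(∫ x, χ x • bm (φ N) w x) - ∫ x, (χ x * ρ t x) • u t x‖ ≤ Cχ * D := by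
            rw [h3]; exact momentum_dev hχ hCχ (hφc N) hUc w
          have h4 := avg_norm_le w
          calc ‖empiricalMomentumField w χ - ∫ x, (χ x * ρ t x) • u t x‖
              ≤ ‖empiricalMomentumField w χ - ∫ x, χ x • bm (φ N) w x‖ +
                ‖(∫ x, χ x • bm (φ N) w x) - ∫ x, (χ x * ρ t x) • u t x‖ :=
                norm_sub_le_norm_sub_add_norm_sub _ _ _
            _ ≤ ε₁ * (1 / 2 + (1 + |Etot|)) + Cχ * D := by
                refine add_le_add (h1.trans (mul_le_mul_of_nonneg_left (h4.trans ?_) hε₁.le)) h2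
                linarith
            _ ≤ δ / 2 := by linarith
        · have h1 := energy_comm (hφc N) (hφ0 N) (hφ1 N) hsuppN hχ hmod w
          have h2 : |(∫ x, χ x * bE (φ N) w x) -
              ∫ x, χ x * totalEnergyDensity (ρ t x) (u t x) (θ t x)| ≤ Cχ * D :=
            energy_dev hχ hCχ (hφc N) hUc w
          calc |empiricalEnergyField w χ - ∫ x, χ x * totalEnergyDensity (ρ t x) (u t x) (θ t x)|
              ≤ |empiricalEnergyField w χ - ∫ x, χ x * bE (φ N) w x| +
                |(∫ x, χ x * bE (φ N) w x) - ∫ x, χ x * totalEnergyDensity (ρ t x) (u t x) (θ t x)| :=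
                abs_sub_le _ _ _
            _ ≤ ε₁ * (1 + |Etot|) + Cχ * D :=
                add_le_add (h1.trans (mul_le_mul_of_nonneg_left heb hε₁.le)) h2
            _ ≤ δ / 2 := by linarith
      · right
        rw [hfz]
        have h1 : κ / 2 < (1 + 2 / κ) / m * I := by linarith
        have h2 : κ' = (κ / 2) / ((1 + 2 / κ) / m) := by
          rw [hκ'def]; field_simp
        rw [h2, div_le_iff₀ (by positivity)]
        linarith
    constructor
    · filter_upwards [hae] with z hz
      by_cases hzG : z ∈ G N
      · exact (hdet z hzG hz).1
      · have hz0 : f N z = 0 := indicator_of_notMem hzG _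
        rw [hz0]
        exact le_rfl
    · filter_upwards [hae] with z hz hzG
      exact (hdet z hzG hz).2
  -- the three fields by the Markov assembly
  have hf0 : ∀ᶠ N in atTop, 0 ≤ᵐ[P N] f N := hcore.mono fun N h => h.1
  refine ⟨?_, ?_, ?_⟩
  · refine tendsto_measure_of_markov P G _ f hκ' hGc hGi hlim hf0 (hcore.mono fun N h => ?_)
    filter_upwards [h.2] with z hz hzE hzG
    rcases hz hzG with h3 | h3
    · exact absurd h3.1 (not_le.2 ((half_lt_self hδ).trans hzE))
    · exact h3
  · refine tendsto_measure_of_markov P G _ f hκ' hGc hGi hlim hf0 (hcore.mono fun N h => ?_)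
    filter_upwards [h.2] with z hz hzE hzG
    rcases hz hzG with h3 | h3
    · exact absurd h3.2.1 (not_le.2 ((half_lt_self hδ).trans hzE))
    · exact h3
  · refine tendsto_measure_of_markov P G _ f hκ' hGc hGi hlim hf0 (hcore.mono fun N h => ?_)
    filter_upwards [h.2] with z hz hzE hzG
    rcases hz hzG with h3 | h3
    · exact absurd h3.2.2 (not_le.2 ((half_lt_self hδ).trans hzE))
    · exact h3

end Barycentric

end Summit.AtomisticToContinuum.HydrodynamicLimit.Theorems.MacroClosureLine

end
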